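import Mathlib.RingTheory.IntegralClosure.IntegrallyClosed
import Mathlib.RingTheory.IntegralClosure.IsIntegralClosure.Basic
import Mathlib.FieldTheory.Minpoly.IsIntegrallyClosed
import Mathlib.FieldTheory.Normal.Defs
import Mathlib.RingTheory.Ideal.GoingUp
import Mathlib.RingTheory.TensorProduct.Basic
import Mathlib.RingTheory.Localization.FractionRing
import HarnessLib

/-!
# Primes of `C ⊗_A B` over the generic point of the normalization `B` are graphs of embeddings

Topic: `Literature/AlgebraicGeometry/Resolution`. The commutative-algebra engine of de Jong 1996,
4.16 (`AlterationsStrictTransform.lean`, named fact `DeJong1996GaloisNormalization`):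

> "Choose a finite separable Galois extension `k(Y) ⊂ L` such that `k(Zᵢ)` may be embedded over
> `k(Y)` into `L` for all `i` […]. Let `Y'` be the normalization of `Y` in the field `L` […].
> we see that `Z' = Z'₁ ∪ … ∪ Z'ₙ` with `Z'ᵢ → Y'` finite and birational." (p. 71)

Affine-locally over a normal affine open `Spec A` of `Y` (`A` an integrally closed domain with
fraction field `K`), `Y'` is `Spec B` with `B` the integral closure of `A` in the normal
extension `L` of `K`, a component `Zᵢ` is `Spec C` with `C` a domain integral over `A`, embedded
into `B` by the chosen embedding `k(Zᵢ) ⊂ L`, and `Zᵢ ×_Y Y' = Spec (C ⊗_A B)`. The points of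
`Zᵢ ×_Y Y'` over the generic point of `Y'` are the primes `𝔔 ⊂ C ⊗_A B` with `𝔔 ∩ B = 0`, and
the sections of `Zᵢ ×_Y Y' → Y'` given by `A`-algebra maps `e' : C → B` pass, over the generic
point, through the primes `ker (e' ⊗ id : C ⊗_A B → B)`. PROVED here:

* `exists_algHom_eq_ker_lift_of_comap_eq_bot` — **every prime `𝔔` of `C ⊗_A B` with
  `𝔔 ∩ B = 0` is `ker (e' ⊗ id)` for some `A`-algebra map `e' : C → B`**, as soon as ONE
  injective `A`-algebra map `e : C → B` exists and `L/K` is normal: the domain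
  `D = (C ⊗_A B)/𝔔` contains `B` and `C`; in `Frac D ⊃ L` every element of `C` is a root of
  the minimal polynomial over `K` of the corresponding element `e(c) ∈ L`, which splits in the
  normal `L`, so `C ⊂ L`; being integral over `A`, `D ⊂ B`, and `𝔔` is the kernel of the
  resulting retraction `C ⊗_A B → B`.

Only the normality of `L/K` is used (no Galois group), as in the printed argument.

## Sources

* A. J. de Jong, *Smoothness, semi-stability and alterations*, Publ. Math. IHÉS 83 (1996), 4.16
  (p. 71).
* The Stacks Project, Tag 0BRK ff. (normalization in a normal extension), Tag 09GJ.
-/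

noncomputable section

open Algebra TensorProduct Polynomial

namespace Literature.AlgebraicGeometry.Resolution

universe u

section Engine

variable {A B C : Type*} [CommRing A] [IsDomain A] [IsIntegrallyClosed A]
  [CommRing B] [IsDomain B] [CommRing C] [IsDomain C]
  [Algebra A B] [Algebra A C] [Algebra.IsIntegral A C]

/-- **Primes of `C ⊗_A B` over the zero ideal of the normalization `B` are kernels of
retractions.** Let `A` be an integrally closed domain with fraction field `K`, `L/K` a normal
field extension, `B` the integral closure of `A` in `L` (with `Frac B = L`), and `C` a domain
integral over `A` admitting an injective `A`-algebra map `e : C → B`. Then every prime ideal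
`𝔔` of `C ⊗_A B` whose contraction to `B` is zero is the kernel of
`e' ⊗ id : C ⊗_A B → B` for some `A`-algebra map `e' : C → B`. [cite: DeJong1996, 4.16, p. 71] -/
theorem exists_algHom_eq_ker_lift_of_comap_eq_bot (K L : Type*) [Field K] [Field L]
    [Algebra A K] [IsFractionRing A K] [Algebra B L] [IsFractionRing B L] [Algebra K L]
    [Algebra A L] [IsScalarTower A K L] [IsScalarTower A B L] [IsIntegralClosure B A L]
    [Normal K L] (e : C →ₐ[A] B)
    (he : Function.Injective e) (Q : Ideal (C ⊗[A] B)) [Q.IsPrime]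
    (hQ : Q.comap (Algebra.TensorProduct.includeRight : B →ₐ[A] C ⊗[A] B).toRingHom = ⊥) :
    ∃ e' : C →ₐ[A] B, Q = RingHom.ker
      (Algebra.TensorProduct.lift e' (AlgHom.id A B) fun _ _ => Commute.all _ _) := by
  classical
  -- injectivity of the structure maps into `L`
  have hBL : Function.Injective (algebraMap B L) := IsFractionRing.injective B L
  have hAB : Function.Injective (algebraMap A B) := by
    intro a b hab
    apply IsFractionRing.injective A K
    apply (algebraMap K L).injective
    rw [← IsScalarTower.algebraMap_apply, ← IsScalarTower.algebraMap_apply,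
      IsScalarTower.algebraMap_apply A B L, hab, ← IsScalarTower.algebraMap_apply]
  haveI : Algebra.IsIntegral A B := IsIntegralClosure.isIntegral_algebra A L
  -- the domain `D = (C ⊗ B)/𝔔` with `B ⊂ D` and `C ⊂ D`
  set D := (C ⊗[A] B) ⧸ Q with hD
  let π : C ⊗[A] B →ₐ[A] D := Ideal.Quotient.mkₐ A Q
  have hπ : Function.Surjective π := Ideal.Quotient.mk_surjective
  have hkerπ : RingHom.ker π.toRingHom = Q := Ideal.mk_ker
  let iB : B →ₐ[A] D := π.comp Algebra.TensorProduct.includeRight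
  let iC : C →ₐ[A] D := π.comp Algebra.TensorProduct.includeLeft
  have hiB : Function.Injective iB := by
    rw [injective_iff_map_eq_zero]
    intro b hb
    have : b ∈ Q.comap (Algebra.TensorProduct.includeRight : B →ₐ[A] C ⊗[A] B).toRingHom := by
      rw [Ideal.mem_comap]
      exact Ideal.Quotient.eq_zero_iff_mem.mp hb
    rwa [hQ, Ideal.mem_bot] at this
  have hiC : Function.Injective iC := by
    -- its kernel is a prime of `C` over `0 ⊂ A`, hence zero (`C` integral over `A`)
    have hker : RingHom.ker iC.toRingHom = ⊥ := by
      haveI : (RingHom.ker iC.toRingHom).IsPrime := RingHom.ker_isPrime _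
      refine Ideal.eq_bot_of_comap_eq_bot (R := A) ?_
      rw [eq_bot_iff]
      intro a ha
      rw [Ideal.mem_comap, RingHom.mem_ker] at ha
      have h1 : iB (algebraMap A B a) = 0 := by
        rw [AlgHom.commutes]
        rw [AlgHom.toRingHom_eq_coe, AlgHom.coe_toRingHom, AlgHom.commutes] at ha
        exact ha
      have h2 : algebraMap A B a = 0 := hiB (by rw [h1, map_zero])
      exact Ideal.mem_bot.mpr (hAB (by rw [h2, map_zero]))
    exact (RingHom.injective_iff_ker_eq_bot _).mpr hker
  -- the fraction field `F` of `D` and `L ⊂ F`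
  let F := FractionRing D
  letI algBF : Algebra B F := ((algebraMap D F).comp iB.toRingHom).toAlgebra
  have hBF : Function.Injective (algebraMap B F) :=
    (IsFractionRing.injective D F).comp hiB
  let jL : L →+* F := IsFractionRing.lift hBF
  have hjL : ∀ b : B, jL (algebraMap B L b) = algebraMap D F (iB b) := fun b =>
    IsFractionRing.lift_algebraMap hBF b
  have hjLinj : Function.Injective jL := jL.injective
  -- compatibility of `A → F` through `B` and through `C`
  have hAF : ∀ a : A, jL (algebraMap A L a) = algebraMap D F (algebraMap A D a) := by
    intro a
    rw [IsScalarTower.algebraMap_apply A B L, hjL, AlgHom.commutes]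
  -- every element of `C` lands in `L`: roots of split minimal polynomials
  have hCmem : ∀ c : C, algebraMap D F (iC c) ∈ jL.range := by
    intro c
    set b : B := e c with hb
    have hbint : IsIntegral A b := Algebra.IsIntegral.isIntegral b
    set q : A[X] := minpoly A b with hq
    -- `q.map (A → L)` is the minimal polynomial of `b` over `K`, so it splits in the normal `L`
    have hsplit : (q.map (algebraMap A L)).Splits := by
      have h1 : minpoly K (algebraMap B L b) = q.map (algebraMap A K) :=
        minpoly.isIntegrallyClosed_eq_field_fractions K L hbint
      have h2 := Normal.splits ‹Normal K L› (algebraMap B L b)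
      rw [h1, Polynomial.map_map, ← IsScalarTower.algebraMap_eq] at h2
      exact h2
    have hq0 : q.map (algebraMap A L) ≠ 0 :=
      (Polynomial.map_monic_ne_zero (minpoly.monic hbint))
    -- `δ = image of c` is a root: `q(c) = 0` as `e(q(c)) = q(e c) = q(b) = 0`
    have hqc : aeval c q = 0 := by
      apply he
      rw [← Polynomial.aeval_algHom_apply, map_zero]
      exact minpoly.aeval A b
    have hroot : ((q.map (algebraMap A L)).map jL).IsRoot (algebraMap D F (iC c)) := by
      have hcomp : jL.comp (algebraMap A L) =
          ((algebraMap D F).comp (iC : C →+* D)).comp (algebraMap A C) := by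
        ext a
        simp only [RingHom.coe_comp, Function.comp_apply, hAF, AlgHom.coe_toRingHom,
          AlgHom.commutes]
      rw [Polynomial.IsRoot, Polynomial.eval_map, Polynomial.eval₂_map, hcomp]
      change Polynomial.eval₂ (((algebraMap D F).comp (iC : C →+* D)).comp (algebraMap A C))
        (((algebraMap D F).comp (iC : C →+* D)) c) q = 0
      rw [← Polynomial.hom_eval₂, ← Polynomial.aeval_def, hqc, map_zero]
    exact hsplit.mem_range_of_isRoot hq0 hroot
  -- hence all of `D` lands in `L`
  have hDmem : ∀ d : D, algebraMap D F d ∈ jL.range := by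
    intro d
    obtain ⟨t, rfl⟩ := hπ d
    induction t using TensorProduct.induction_on with
    | zero => exact ⟨0, by rw [map_zero, map_zero, map_zero]⟩
    | tmul c b =>
      have e1 : π (c ⊗ₜ[A] b) = iC c * iB b := by
        change π (c ⊗ₜ[A] b) = π (c ⊗ₜ[A] 1) * π (1 ⊗ₜ[A] b)
        rw [← map_mul, Algebra.TensorProduct.tmul_mul_tmul, mul_one, one_mul]
      rw [e1, map_mul]
      obtain ⟨l, hl⟩ := hCmem c
      exact ⟨l * algebraMap B L b, by rw [map_mul, hl, hjL]⟩
    | add x y hx hy =>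
      rw [map_add, map_add]
      exact Subring.add_mem _ hx hy
  -- the ring map `ρ : D → L` with `jL ∘ ρ = (D → F)`
  have hρex : ∃ ρ : D →+* L, ∀ d, jL (ρ d) = algebraMap D F d := by
    let E : L ≃+* jL.range := RingEquiv.ofBijective jL.rangeRestrict
      ⟨fun x y hxy => hjLinj (Subtype.ext_iff.mp hxy), jL.rangeRestrict_surjective⟩
    refine ⟨E.symm.toRingHom.comp ((algebraMap D F).codRestrict jL.range hDmem), fun d => ?_⟩
    have : jL (E.symm ((algebraMap D F).codRestrict jL.range hDmem d)) =
        ((E (E.symm ((algebraMap D F).codRestrict jL.range hDmem d))) : F) := rfl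
    rw [RingHom.comp_apply, RingEquiv.toRingHom_eq_coe, RingEquiv.coe_toRingHom, this,
      RingEquiv.apply_symm_apply]
    rfl
  obtain ⟨ρ, hρ⟩ := hρex
  have hρinj : Function.Injective ρ := fun x y hxy =>
    IsFractionRing.injective D F (by rw [← hρ, ← hρ, hxy])
  have hρA : ∀ a : A, ρ (algebraMap A D a) = algebraMap A L a := fun a =>
    hjLinj (by rw [hρ, hAF])
  have hρiB : ∀ b : B, ρ (iB b) = algebraMap B L b := fun b => hjLinj (by rw [hρ, hjL])
  -- `ρ` is an `A`-algebra map into `L` from the integral `D`, so it factors through `B`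
  let ρₐ : D →ₐ[A] L := { ρ with commutes' := hρA }
  haveI : Algebra.IsIntegral A (C ⊗[A] B) := by
    refine ⟨fun t => ?_⟩
    induction t using TensorProduct.induction_on with
    | zero => exact isIntegral_zero
    | tmul c b =>
      have hcb : c ⊗ₜ[A] b = (c ⊗ₜ[A] (1 : B)) * ((1 : C) ⊗ₜ[A] b) := by
        rw [Algebra.TensorProduct.tmul_mul_tmul, mul_one, one_mul]
      rw [hcb]
      exact ((Algebra.IsIntegral.isIntegral (R := A) c).map
        (Algebra.TensorProduct.includeLeft : C →ₐ[A] C ⊗[A] B)).mul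
        ((Algebra.IsIntegral.isIntegral (R := A) b).map
          (Algebra.TensorProduct.includeRight : B →ₐ[A] C ⊗[A] B))
    | add x y hx hy => exact hx.add hy
  have hDint : ∀ d : D, IsIntegral A (ρ d) := fun d => by
    obtain ⟨t, rfl⟩ := hπ d
    exact ((Algebra.IsIntegral.isIntegral (R := A) t).map π).map ρₐ
  let ρB : D →ₐ[A] B :=
    { toFun := fun d => IsIntegralClosure.mk' B (ρ d) (hDint d)
      map_one' := by simp only [map_one, IsIntegralClosure.mk'_one]
      map_zero' := by simp only [map_zero, IsIntegralClosure.mk'_zero]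
      map_add' := fun x y => by simp only [map_add, ← IsIntegralClosure.mk'_add]
      map_mul' := fun x y => by simp only [map_mul, ← IsIntegralClosure.mk'_mul]
      commutes' := fun a => hBL (by
        rw [IsIntegralClosure.algebraMap_mk', ← IsScalarTower.algebraMap_apply]
        exact hρA a) }
  have hρB : ∀ d : D, algebraMap B L (ρB d) = ρ d := fun d =>
    IsIntegralClosure.algebraMap_mk' B (ρ d) (hDint d)
  have hρBinj : Function.Injective ρB := fun x y hxy => hρinj (by rw [← hρB, ← hρB, hxy])
  have hρBiB : ∀ b : B, ρB (iB b) = b := fun b => hBL (by rw [hρB]; exact hρiB b)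
  -- the retraction `e' ⊗ id = ρB ∘ π`
  let e' : C →ₐ[A] B := ρB.comp iC
  have hlift : Algebra.TensorProduct.lift e' (AlgHom.id A B) (fun _ _ => Commute.all _ _) =
      ρB.comp π := by
    apply Algebra.TensorProduct.ext'
    intro c b
    have e1 : π (c ⊗ₜ[A] b) = iC c * iB b := by
      change π (c ⊗ₜ[A] b) = π (c ⊗ₜ[A] 1) * π (1 ⊗ₜ[A] b)
      rw [← map_mul, Algebra.TensorProduct.tmul_mul_tmul, mul_one, one_mul]
    rw [Algebra.TensorProduct.lift_tmul]
    change ρB (iC c) * b = ρB (π (c ⊗ₜ[A] b))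
    rw [e1, map_mul, hρBiB]
  refine ⟨e', ?_⟩
  rw [hlift]
  ext t
  rw [RingHom.mem_ker]
  change t ∈ Q ↔ ρB (π t) = 0
  rw [← map_zero ρB, hρBinj.eq_iff]
  exact (Ideal.Quotient.eq_zero_iff_mem).symm

end Engine

end Literature.AlgebraicGeometry.Resolution

end
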